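import Summits.CriticalPhenomena.PercolationContinuityZ3.Theorems.PercNearOneGluingNoHeavyQuantThreePortResidualKit
import HarnessLib

/-!
# `Z(3,2)` at a three-port observer with hairs `≥ 2/5` — the dominant-row Gladkov–Zimin solver

builds on p205010 (kernel theorem, internal audit signed; external expert review pending)

Support file (`--supports stmt-CriticalPhenomena-4575`), seat `prim-quant-p1` (gen 5); memo `run/shared/lean/prim/quant/P1-SURPLUS.md` §15.
No definitions, no named facts, no sorries; standard axioms.

SETTING (`ThreePort`): three-port observer `o` (pairs at `o` other than `o–a, o–b, o–c` have weight `0`), hairs `α, β, γ`,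
ARBITRARY finite weighted graph off `o`, off-`o` cells `U0, Uab, Uac, Ubc, U3` (the five-cell law of the partition of `{a,b,c}`
by the clusters of `ω ∩ {e | o ∉ e}`).  `ThreePort.le_one_reached_le_of_cellSolver` (p219849) reduces `Z(3,2)` at `o` to refuting
the real system {cells `≥ 0`, `Σ = 1`, three failed exchanges `U_opp(v)·V_v < U0·T_v⁻`, three Gladkov–Zimin rows, `Σ_v q_v > 2`}.
p219549 refuted it for hairs in `[9/20, ½]` with ONE GZ row and box constants.  This file refutes it on the larger box
`[2/5, ½]³` with the GZ row AT THE DOMINANT APEX and hair-dependent (not box-constant) coefficients: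

* `ThreePort.twoFifths_residual_false_of_le` (pure real algebra, `γ = max` hair) — CHAIN.  Caps: `V_a = (1−α)β + (1−β)(γ−α) ≥ 1/5`,
  `V_b ≥ 1/5`, `V_c + T_c⁻ = (1−γ)(α+β−2αβ) ≥ 6/25`, so `Ubc ≤ 5T_a⁻·U0`, `Uac ≤ 5T_b⁻·U0`, `Uab ≤ (25/6)T_c⁻·I` with `I = U0 + Uab`;
  the identities `T_a⁻ + T_b⁻ = (α+β−2αβ)(1−2γ)` and `T_c⁻ = (½+γ−α−β)/2 − (1−2α)(1−2β)(1−2γ)/4` give the LINEAR-in-hairs caps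
  `Uac + Ubc ≤ k·U0`, `Uab ≤ ρ·I` with `k = (5/2)(1−2γ)`, `ρ = (25/12)(½+γ−α−β)`.  GZ at apex `c`: `I·J ≤ Uab+Uac+Ubc ≤ (k+ρ)·I`
  (`J = 1 − I`), so `J ≤ u := k + ρ`.  `Σ > 2` plus `(c₃ − ½)·`GZ, `c_pair ≤ ½`, `9/8 ≤ c₃ ≤ 29/25` (`c3_bounds`, multilinear
  interpolation on the box) give `2 < s + (29/25)ρ I + (29/25)J − (5/8)IJ`; with `IJ ≥ (1−u)J` this is `2 < s + (29/25)ρ + M·J`,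
  `M = 29/25 − (29/25)ρ − (5/8)(1−u)`, and both `s + (29/25)ρ ≤ 2` (linear) and `s + (29/25)ρ + M·u ≤ 2`
  (`twoFifths_quadratic_bound`, a quadratic in `w = 1−α−β`, `z = ½−γ` on the triangle `0 ≤ 2z ≤ w ≤ 1/5`, exact certificate) hold.
* `ThreePort.twoFifths_residual_false` — all of `[2/5, ½]³` (relabel so that the largest hair is `γ`; uses the GZ row of that apex,
  hence all three rows `gz_offObserver`, `_apex_b`, `_apex_c` of p219849 appear).
* `ThreePort.le_one_reached_le_of_twoFifths_hairs` — **`Z(3,2)` at every three-port observer with hairs in `[2/5, ½]`, for every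
  finite weighted graph off `o`**; `…_of_hairs_ge_twoFifths`: all hairs `≥ 2/5` suffice (a hair `≥ ½` is the heavy-hair theorem).
NUMBERS.  Abstract optimum of 'caps + three GZ rows' on the box: `1.90` (at `(2/5, 2/5, ½)`); the chain's final slack is `0.087`
there and `0.037` at `(2/5, 2/5, 2/5)`; the method (all known rows) cannot pass `≈ 0.37` on the full cube and is void in the
near-dominant corner, where the abstract system is feasible near glue (memo §15).
[cite: GladkovZimin2024, Thm. 4.6]; [cite: KozmaNitzan2024, Lemma 2 (p. 6)] (context: level 1 of the family).
-/

noncomputable section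

namespace Summit.CriticalPhenomena.PercolationContinuityZ3.Theorems

open MeasureTheory Set Literature.Probability.LatticeModels Literature.Probability.Percolation
open scoped Classical BigOperators

variable {n : ℕ}

namespace ThreePort

/-! ### Real-algebra lemmas on the hair box `[2/5, ½]³` -/

/-- On `[2/5, ½]³` the glued-cell coefficient `c₃ = Σ_v (1−h_v)(h_u+h_w−h_u h_w)` lies in `[9/8, 29/25]`
(multilinear, so it is the interpolation of its eight vertex values `9/8, 23/20, 29/25, 144/125`). [this work] -/
theorem c3_bounds (α β γ : ℝ) (hα0 : 2 / 5 ≤ α) (hα1 : α ≤ 1 / 2) (hβ0 : 2 / 5 ≤ β) (hβ1 : β ≤ 1 / 2)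
    (hγ0 : 2 / 5 ≤ γ) (hγ1 : γ ≤ 1 / 2) :
    9 / 8 ≤ (1 - α) * (β + γ - β * γ) + (1 - β) * (α + γ - α * γ) + (1 - γ) * (α + β - α * β) ∧
      (1 - α) * (β + γ - β * γ) + (1 - β) * (α + γ - α * γ) + (1 - γ) * (α + β - α * β) ≤ 29 / 25 := by
  have pa : 0 ≤ α - 2 / 5 := by linarith
  have qa : 0 ≤ 1 / 2 - α := by linarith
  have pb : 0 ≤ β - 2 / 5 := by linarith
  have qb : 0 ≤ 1 / 2 - β := by linarith
  have pc : 0 ≤ γ - 2 / 5 := by linarith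
  have qc : 0 ≤ 1 / 2 - γ := by linarith
  have v1 := mul_nonneg (mul_nonneg pa pb) pc
  have v2 := mul_nonneg (mul_nonneg pa pb) qc
  have v3 := mul_nonneg (mul_nonneg pa qb) pc
  have v4 := mul_nonneg (mul_nonneg pa qb) qc
  have v5 := mul_nonneg (mul_nonneg qa pb) pc
  have v6 := mul_nonneg (mul_nonneg qa pb) qc
  have v7 := mul_nonneg (mul_nonneg qa qb) pc
  have v8 := mul_nonneg (mul_nonneg qa qb) qc
  constructor
  · linarith only [v1, v2, v3, v4, v5, v6, v7, v8]
  · linarith only [v1, v2, v3, v4, v5, v6, v7, v8]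

/-- The closing quadratic: with `w = 1−α−β`, `z = ½−γ` on the triangle `0 ≤ 2z ≤ w ≤ 1/5`, `ρ = (25/12)(w−z)`, `u = 5z + ρ`,
`s = 3/2 − w − z`: `s + (29/25)ρ + (29/25 − (29/25)ρ − (5/8)(1−u))·u ≤ 2` (exact certificate
`2 − LHS = (14245/2304)z(w−2z) + (42641/23040)(1/5−w) + (9035/768)(1/5−w)z + (2675/1152)(1/5−w)² + (1907/7680)(w−2z) + 4259/115200`).
[this work] -/
theorem twoFifths_quadratic_bound (w z : ℝ) (hz : 0 ≤ z) (h2z : 2 * z ≤ w) (hw : w ≤ 1 / 5) :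
    (3 / 2 - w - z) + 29 / 25 * (25 / 12 * (w - z)) +
        (29 / 25 - 29 / 25 * (25 / 12 * (w - z)) - 5 / 8 * (1 - (5 * z + 25 / 12 * (w - z)))) *
          (5 * z + 25 / 12 * (w - z)) ≤ 2 := by
  linarith only [mul_nonneg hz (sub_nonneg.2 h2z), mul_nonneg (sub_nonneg.2 hw) hz,
    mul_nonneg (sub_nonneg.2 hw) (sub_nonneg.2 hw), sub_nonneg.2 hw, sub_nonneg.2 h2z]

/-- **Pure real algebra, dominant apex `c`.**  Hairs `2/5 ≤ α, β ≤ γ ≤ ½`, nonnegative cells summing to `1`, the three failed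
exchanges (`ThreePort.margin_eq` form), the Gladkov–Zimin row AT APEX `c`, `(U0+Uab)(Uac+Ubc+U3) ≤ Uab+Uac+Ubc`, and
`Σ_v μ(o↔v) > 2` (collected by cells) are contradictory.  Chain in the file header. [this work] -/
theorem twoFifths_residual_false_of_le (α β γ U0 Uab Uac Ubc U3 : ℝ)
    (hα0 : 2 / 5 ≤ α) (hαγ : α ≤ γ) (hβ0 : 2 / 5 ≤ β) (hβγ : β ≤ γ) (hγ1 : γ ≤ 1 / 2)
    (h0 : 0 ≤ U0) (hab : 0 ≤ Uab) (hac : 0 ≤ Uac) (hbc : 0 ≤ Ubc) (h3 : 0 ≤ U3)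
    (hsum : Uab + Uac + Ubc + U3 + U0 = 1)
    (ga : U0 * ((1 - α) * β * γ - α * (1 - β) * (1 - γ)) + Ubc * (β + γ - β * γ - α) < 0)
    (gb : U0 * ((1 - β) * α * γ - β * (1 - α) * (1 - γ)) + Uac * (α + γ - α * γ - β) < 0)
    (gc : U0 * ((1 - γ) * α * β - γ * (1 - α) * (1 - β)) + Uab * (α + β - α * β - γ) < 0)
    (hGZ : (U0 + Uab) * (Uac + Ubc + U3) ≤ Uab + Uac + Ubc)
    (hSig : 2 < (α + β + γ) + (α + β - 2 * α * β) * Uab + (α + γ - 2 * α * γ) * Uac + (β + γ - 2 * β * γ) * Ubc +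
      ((1 - α) * (β + γ - β * γ) + (1 - β) * (α + γ - α * γ) + (1 - γ) * (α + β - α * β)) * U3) : False := by
  have hα1 : α ≤ 1 / 2 := hαγ.trans hγ1
  have hβ1 : β ≤ 1 / 2 := hβγ.trans hγ1
  have hγ0 : 2 / 5 ≤ γ := hα0.trans hαγ
  -- the two closing polynomial bounds, stated before any abbreviation is introduced
  have hP1 : (α + β + γ) + 29 / 25 * (25 / 12 * (1 / 2 + γ - α - β)) ≤ 2 := by linarith only [hα0, hβ0, hγ1]
  have hP2 : (α + β + γ) + 29 / 25 * (25 / 12 * (1 / 2 + γ - α - β)) +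
      (29 / 25 - 29 / 25 * (25 / 12 * (1 / 2 + γ - α - β)) -
          5 / 8 * (1 - (5 / 2 * (1 - 2 * γ) + 25 / 12 * (1 / 2 + γ - α - β)))) *
        (5 / 2 * (1 - 2 * γ) + 25 / 12 * (1 / 2 + γ - α - β)) ≤ 2 := by
    have h := twoFifths_quadratic_bound (1 - α - β) (1 / 2 - γ) (by linarith only [hγ1])
      (by linarith only [hαγ, hβγ]) (by linarith only [hα0, hβ0])
    linarith only [h]
  obtain ⟨hc3lo, hc3hi⟩ := c3_bounds α β γ hα0 hα1 hβ0 hβ1 hγ0 hγ1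
  -- the failed exchanges as caps `U_opp(v)·V_v < U0·T_v⁻`
  have ga' : Ubc * (β + γ - β * γ - α) < U0 * (α * (1 - β) * (1 - γ) - (1 - α) * β * γ) := by linarith only [ga]
  have gb' : Uac * (α + γ - α * γ - β) < U0 * (β * (1 - α) * (1 - γ) - (1 - β) * α * γ) := by linarith only [gb]
  have gc' : Uab * (α + β - α * β - γ) < U0 * (γ * (1 - α) * (1 - β) - (1 - γ) * α * β) := by linarith only [gc]
  -- `V_a, V_b ≥ 1/5`, `V_c > 0` (here `γ` is the largest hair)
  have hVa : 1 / 5 ≤ β + γ - β * γ - α := by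
    have e : β + γ - β * γ - α = (1 - α) * β + (1 - β) * (γ - α) := by ring
    have h1 : 1 / 2 * (2 / 5) ≤ (1 - α) * β := mul_le_mul (by linarith only [hα1]) hβ0 (by norm_num) (by linarith only [hα1])
    have h2 : 0 ≤ (1 - β) * (γ - α) := mul_nonneg (by linarith only [hβ1]) (by linarith only [hαγ])
    linarith only [e, h1, h2]
  have hVb : 1 / 5 ≤ α + γ - α * γ - β := by
    have e : α + γ - α * γ - β = (1 - β) * α + (1 - α) * (γ - β) := by ring
    have h1 : 1 / 2 * (2 / 5) ≤ (1 - β) * α := mul_le_mul (by linarith only [hβ1]) hα0 (by norm_num) (by linarith only [hβ1])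
    have h2 : 0 ≤ (1 - α) * (γ - β) := mul_nonneg (by linarith only [hα1]) (by linarith only [hβγ])
    linarith only [e, h1, h2]
  have hVc : 0 < α + β - α * β - γ := by
    have e : α + β - α * β - γ = (1 - γ) - (1 - α) * (1 - β) := by ring
    have h1 : (1 - α) * (1 - β) ≤ 3 / 5 * (3 / 5) :=
      mul_le_mul (by linarith only [hα0]) (by linarith only [hβ0]) (by linarith only [hβ1]) (by norm_num)
    linarith only [e, h1, hγ1]
  -- pair coefficients `≤ ½`, `c_ab ≥ 12/25`, `(1−γ)·c_ab ≥ 6/25`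
  have hcab1 : α + β - 2 * α * β ≤ 1 / 2 := by
    have : 0 ≤ (1 - 2 * α) * (1 - 2 * β) := mul_nonneg (by linarith only [hα1]) (by linarith only [hβ1])
    linarith only [this]
  have hcac1 : α + γ - 2 * α * γ ≤ 1 / 2 := by
    have : 0 ≤ (1 - 2 * α) * (1 - 2 * γ) := mul_nonneg (by linarith only [hα1]) (by linarith only [hγ1])
    linarith only [this]
  have hcbc1 : β + γ - 2 * β * γ ≤ 1 / 2 := by
    have : 0 ≤ (1 - 2 * β) * (1 - 2 * γ) := mul_nonneg (by linarith only [hβ1]) (by linarith only [hγ1])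
    linarith only [this]
  have hcab0 : 12 / 25 ≤ α + β - 2 * α * β := by
    have : (1 - 2 * α) * (1 - 2 * β) ≤ 1 / 5 * (1 / 5) :=
      mul_le_mul (by linarith only [hα0]) (by linarith only [hβ0]) (by linarith only [hβ1]) (by norm_num)
    linarith only [this]
  have hD : 6 / 25 ≤ (1 - γ) * (α + β - 2 * α * β) := by
    have := mul_le_mul (show (1 : ℝ) / 2 ≤ 1 - γ by linarith only [hγ1]) hcab0 (by norm_num)
      (by linarith only [hγ1])
    linarith only [this]
  -- `U0 > 0`
  have hU0 : 0 < U0 := by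
    by_contra h
    have hz : U0 = 0 := le_antisymm (not_lt.1 h) h0
    have h1 : 0 ≤ Uab * (α + β - α * β - γ) := mul_nonneg hab hVc.le
    rw [hz, zero_mul] at gc'
    exact absurd gc' (not_lt.2 h1)
  -- the caps with the constants cleared
  have hUbc : Ubc ≤ 5 * (α * (1 - β) * (1 - γ) - (1 - α) * β * γ) * U0 := by
    have h1 : 1 / 5 * Ubc ≤ Ubc * (β + γ - β * γ - α) := by
      rw [mul_comm Ubc]; exact mul_le_mul_of_nonneg_right hVa hbc
    linarith only [h1, ga']
  have hUac : Uac ≤ 5 * (β * (1 - α) * (1 - γ) - (1 - β) * α * γ) * U0 := by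
    have h1 : 1 / 5 * Uac ≤ Uac * (α + γ - α * γ - β) := by
      rw [mul_comm Uac]; exact mul_le_mul_of_nonneg_right hVb hac
    linarith only [h1, gb']
  have hUab : Uab ≤ 25 / 6 * (γ * (1 - α) * (1 - β) - (1 - γ) * α * β) * (U0 + Uab) := by
    have e : α + β - α * β - γ + (γ * (1 - α) * (1 - β) - (1 - γ) * α * β) = (1 - γ) * (α + β - 2 * α * β) := by ring
    have h1 : 6 / 25 * Uab ≤ Uab * ((1 - γ) * (α + β - 2 * α * β)) := by
      rw [mul_comm Uab]; exact mul_le_mul_of_nonneg_right hD hab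
    rw [← e] at h1
    linarith only [h1, gc']
  -- linear-in-hairs majorants of the cap constants
  have hk : 5 * (α * (1 - β) * (1 - γ) - (1 - α) * β * γ) + 5 * (β * (1 - α) * (1 - γ) - (1 - β) * α * γ) ≤
      5 / 2 * (1 - 2 * γ) := by
    have e : (α * (1 - β) * (1 - γ) - (1 - α) * β * γ) + (β * (1 - α) * (1 - γ) - (1 - β) * α * γ) =
        (α + β - 2 * α * β) * (1 - 2 * γ) := by ring
    have h1 : (α + β - 2 * α * β) * (1 - 2 * γ) ≤ 1 / 2 * (1 - 2 * γ) :=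
      mul_le_mul_of_nonneg_right hcab1 (by linarith only [hγ1])
    linarith only [e, h1]
  have hρ : 25 / 6 * (γ * (1 - α) * (1 - β) - (1 - γ) * α * β) ≤ 25 / 12 * (1 / 2 + γ - α - β) := by
    have e : γ * (1 - α) * (1 - β) - (1 - γ) * α * β =
        (1 / 2 + γ - α - β) / 2 - (1 - 2 * α) * (1 - 2 * β) * (1 - 2 * γ) / 4 := by ring
    have h1 : 0 ≤ (1 - 2 * α) * (1 - 2 * β) * (1 - 2 * γ) :=
      mul_nonneg (mul_nonneg (by linarith only [hα1]) (by linarith only [hβ1])) (by linarith only [hγ1])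
    linarith only [e, h1]
  have hk0 : 0 ≤ 5 / 2 * (1 - 2 * γ) := by linarith only [hγ1]
  -- abbreviations
  set c3 : ℝ := (1 - α) * (β + γ - β * γ) + (1 - β) * (α + γ - α * γ) + (1 - γ) * (α + β - α * β) with hc3
  set ρ : ℝ := 25 / 12 * (1 / 2 + γ - α - β) with hρdef
  set k : ℝ := 5 / 2 * (1 - 2 * γ) with hkdef
  set I : ℝ := U0 + Uab with hI
  set J : ℝ := Uac + Ubc + U3 with hJ
  have hIJ : I + J = 1 := by rw [hI, hJ]; linarith only [hsum]
  have hI0 : 0 < I := by rw [hI]; linarith only [hU0, hab]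
  have hIU : U0 ≤ I := by rw [hI]; linarith only [hab]
  have hJ0 : 0 ≤ J := by rw [hJ]; linarith only [hac, hbc, h3]
  -- `Uab ≤ ρ I`, `Uac + Ubc ≤ k U0`
  have hUab' : Uab ≤ ρ * I :=
    hUab.trans (mul_le_mul_of_nonneg_right hρ hI0.le)
  have hpairs : Uac + Ubc ≤ k * U0 := by
    have h2 := mul_le_mul_of_nonneg_right hk h0
    linarith only [hUbc, hUac, h2]
  -- the GZ row at apex `c` bounds `J`
  have hJu : J ≤ k + ρ := by
    have h1 : I * J ≤ I * (k + ρ) := by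
      have h2 : k * U0 ≤ k * I := mul_le_mul_of_nonneg_left hIU hk0
      have h3' : I * J ≤ ρ * I + k * I := by linarith only [hGZ, hUab', hpairs, h2]
      linarith only [h3', mul_comm I (k + ρ), add_mul k ρ I]
    exact le_of_mul_le_mul_left h1 hI0
  -- `Σ > 2` and `(c₃ − ½)·GZ`
  have hU3 : U3 = J - Uac - Ubc := by rw [hJ]; ring
  have hGZ' : (c3 - 1 / 2) * (I * J) ≤ (c3 - 1 / 2) * (Uab + Uac + Ubc) :=
    mul_le_mul_of_nonneg_left hGZ (by linarith only [hc3lo])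
  have tab : (α + β - 2 * α * β + (c3 - 1 / 2)) * Uab ≤ 29 / 25 * Uab :=
    mul_le_mul_of_nonneg_right (by linarith only [hcab1, hc3hi]) hab
  have tac : (α + γ - 2 * α * γ) * Uac ≤ 1 / 2 * Uac := mul_le_mul_of_nonneg_right hcac1 hac
  have tbc : (β + γ - 2 * β * γ) * Ubc ≤ 1 / 2 * Ubc := mul_le_mul_of_nonneg_right hcbc1 hbc
  have tJ : c3 * J ≤ 29 / 25 * J := mul_le_mul_of_nonneg_right hc3hi hJ0
  have tIJ : 5 / 8 * (I * J) ≤ (c3 - 1 / 2) * (I * J) :=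
    mul_le_mul_of_nonneg_right (by linarith only [hc3lo]) (mul_nonneg hI0.le hJ0)
  have hS1 : 2 < (α + β + γ) + 29 / 25 * Uab + 29 / 25 * J - 5 / 8 * (I * J) := by
    have e1 : c3 * U3 = c3 * J - c3 * Uac - c3 * Ubc := by rw [hU3]; ring
    have e2 : (c3 - 1 / 2) * (Uab + Uac + Ubc) =
        c3 * Uab + c3 * Uac + c3 * Ubc - 1 / 2 * Uab - 1 / 2 * Uac - 1 / 2 * Ubc := by ring
    have e3 : (α + β - 2 * α * β + (c3 - 1 / 2)) * Uab = (α + β - 2 * α * β) * Uab + c3 * Uab - 1 / 2 * Uab := by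
      ring
    linarith only [hSig, hGZ', tab, tac, tbc, tJ, tIJ, e1, e2, e3]
  -- convexity step `IJ ≥ (1−u)J`, then the two endpoint bounds
  have hIJ' : (1 - (k + ρ)) * J ≤ I * J := by
    have h1 : 0 ≤ ((k + ρ) - J) * J := mul_nonneg (by linarith only [hJu]) hJ0
    have eI : I = 1 - J := by linarith only [hIJ]
    rw [eI]
    linarith only [h1]
  have hS2 : 2 < (α + β + γ) + 29 / 25 * ρ + (29 / 25 - 29 / 25 * ρ - 5 / 8 * (1 - (k + ρ))) * J := by
    have h1 : 29 / 25 * Uab ≤ 29 / 25 * (ρ * I) := by linarith only [hUab']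
    have eI : I = 1 - J := by linarith only [hIJ]
    rw [eI] at h1
    linarith only [hS1, h1, hIJ']
  rcases le_or_gt (29 / 25 - 29 / 25 * ρ - 5 / 8 * (1 - (k + ρ))) 0 with hM | hM
  · have h1 : (29 / 25 - 29 / 25 * ρ - 5 / 8 * (1 - (k + ρ))) * J ≤ 0 :=
      mul_nonpos_of_nonpos_of_nonneg hM hJ0
    linarith only [hS2, h1, hP1]
  · have h1 : (29 / 25 - 29 / 25 * ρ - 5 / 8 * (1 - (k + ρ))) * J ≤
        (29 / 25 - 29 / 25 * ρ - 5 / 8 * (1 - (k + ρ))) * (k + ρ) := mul_le_mul_of_nonneg_left hJu hM.le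
    linarith only [hS2, h1, hP2]

/-- **Pure real algebra on the whole box `[2/5, ½]³`.**  Nonnegative cells summing to `1`, the three failed exchanges, the three
Gladkov–Zimin rows (apexes `a, b, c`, `a`-dictionary of `ThreePort.gz_offObserver{,_apex_b,_apex_c}`) and `Σ_v μ(o↔v) > 2`
are contradictory: relabel so that the largest hair is the third and apply `twoFifths_residual_false_of_le` with the GZ row of
that apex. [this work] -/
theorem twoFifths_residual_false (α β γ U0 Uab Uac Ubc U3 : ℝ)
    (hα0 : 2 / 5 ≤ α) (hα1 : α ≤ 1 / 2) (hβ0 : 2 / 5 ≤ β) (hβ1 : β ≤ 1 / 2) (hγ0 : 2 / 5 ≤ γ) (hγ1 : γ ≤ 1 / 2)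
    (h0 : 0 ≤ U0) (hab : 0 ≤ Uab) (hac : 0 ≤ Uac) (hbc : 0 ≤ Ubc) (h3 : 0 ≤ U3)
    (hsum : Uab + Uac + Ubc + U3 + U0 = 1)
    (ga : U0 * ((1 - α) * β * γ - α * (1 - β) * (1 - γ)) + Ubc * (β + γ - β * γ - α) < 0)
    (gb : U0 * ((1 - β) * α * γ - β * (1 - α) * (1 - γ)) + Uac * (α + γ - α * γ - β) < 0)
    (gc : U0 * ((1 - γ) * α * β - γ * (1 - α) * (1 - β)) + Uab * (α + β - α * β - γ) < 0)
    (hGZa : (U0 + Ubc) * (Uab + Uac + U3) ≤ Uab + Uac + Ubc)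
    (hGZb : (U0 + Uac) * (Uab + Ubc + U3) ≤ Uab + Uac + Ubc)
    (hGZc : (U0 + Uab) * (Uac + Ubc + U3) ≤ Uab + Uac + Ubc)
    (hSig : 2 < (α + β + γ) + (α + β - 2 * α * β) * Uab + (α + γ - 2 * α * γ) * Uac + (β + γ - 2 * β * γ) * Ubc +
      ((1 - α) * (β + γ - β * γ) + (1 - β) * (α + γ - α * γ) + (1 - γ) * (α + β - α * β)) * U3) : False := by
  rcases le_total α γ with hαγ | hγα
  · rcases le_total β γ with hβγ | hγβ
    · -- `γ` is the largest hair
      exact twoFifths_residual_false_of_le α β γ U0 Uab Uac Ubc U3 hα0 hαγ hβ0 hβγ hγ1 h0 hab hac hbc h3 hsum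
        ga gb gc hGZc hSig
    · -- `β` is the largest hair: swap the roles of `b` and `c`
      exact twoFifths_residual_false_of_le α γ β U0 Uac Uab Ubc U3 hα0 (hαγ.trans hγβ) hγ0 hγβ hβ1 h0 hac hab hbc h3
        (by linarith only [hsum]) (by linarith only [ga]) (by linarith only [gc]) (by linarith only [gb])
        (by linarith only [hGZb]) (by linarith only [hSig])
  · rcases le_total β α with hβα | hαβ
    · -- `α` is the largest hair: swap the roles of `a` and `c`
      exact twoFifths_residual_false_of_le γ β α U0 Ubc Uac Uab U3 hγ0 hγα hβ0 hβα hα1 h0 hbc hac hab h3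
        (by linarith only [hsum]) (by linarith only [gc]) (by linarith only [gb]) (by linarith only [ga])
        (by linarith only [hGZa]) (by linarith only [hSig])
    · -- `β` is the largest hair (`γ ≤ α ≤ β`): swap the roles of `b` and `c`
      exact twoFifths_residual_false_of_le α γ β U0 Uac Uab Ubc U3 hα0 hαβ hγ0 (hγα.trans hαβ) hβ1 h0 hac hab hbc h3
        (by linarith only [hsum]) (by linarith only [ga]) (by linarith only [gc]) (by linarith only [gb])
        (by linarith only [hGZb]) (by linarith only [hSig])

/-! ### The theorems at a three-port observer -/

/-- **`Z(3,2)` at a three-port observer with hairs in `[2/5, ½]`, for every graph off the observer.**  If `o` is adjacent (with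
positive weight) only to `a, b, c`, the three hairs lie in `[2/5, ½]`, `Σ_v μ(o↔v) > 2` and `t ≥ μ(o↮v)` for `v = a, b, c`, then
`μ{o reaches at most one of a, b, c} ≤ t`.  Instance of `le_one_reached_le_of_cellSolver` with the solver `twoFifths_residual_false`.
[this work] -/
theorem le_one_reached_le_of_twoFifths_hairs (w : Sym2 (Fin n) → unitInterval) (R : Finset (Fin n)) (o a b c : Fin n) (t : ℝ)
    (hR : R = {a, b, c}) (hao : a ≠ o) (hbo : b ≠ o) (hco : c ≠ o) (hab : a ≠ b) (hac : a ≠ c) (hbc : b ≠ c)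
    (hobs : ∀ u, u ≠ o → u ≠ a → u ≠ b → u ≠ c → w s(o, u) = 0)
    (hαlo : (2 / 5 : ℝ) ≤ w s(o, a)) (hαhi : (w s(o, a) : ℝ) ≤ 1 / 2)
    (hβlo : (2 / 5 : ℝ) ≤ w s(o, b)) (hβhi : (w s(o, b) : ℝ) ≤ 1 / 2)
    (hγlo : (2 / 5 : ℝ) ≤ w s(o, c)) (hγhi : (w s(o, c) : ℝ) ≤ 1 / 2)
    (hsum : 2 < (prodBernoulli w).real (openConn o a) + (prodBernoulli w).real (openConn o b) +
      (prodBernoulli w).real (openConn o c))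
    (hta : (prodBernoulli w).real (openConn o a)ᶜ ≤ t) (htb : (prodBernoulli w).real (openConn o b)ᶜ ≤ t)
    (htc : (prodBernoulli w).real (openConn o c)ᶜ ≤ t) :
    (prodBernoulli w).real {ω : BondConfig (Fin n) | (R.filter fun v => ω ∈ openConn o v).card ≤ 1} ≤ t :=
  le_one_reached_le_of_cellSolver w R o a b c t hR hao hbo hco hab hac hbc hobs
    (fun U0 Uab Uac Ubc U3 h0 hab' hac' hbc' h3 hs ga gb gc hGZa hGZb hGZc hSig =>
      twoFifths_residual_false _ _ _ U0 Uab Uac Ubc U3 hαlo hαhi hβlo hβhi hγlo hγhi h0 hab' hac' hbc' h3 hs ga gb gc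
        hGZa hGZb hGZc hSig)
    hsum hta htb htc

/-- **All three hairs `≥ 2/5` suffice** (no upper bound): if some hair is at least `½` the heavy-hair theorem
`pocketExchange_of_half_le_hair` gives the exchange at the weakest relay; otherwise `le_one_reached_le_of_twoFifths_hairs`.
Supersedes `le_one_reached_le_of_hairs_ge` (`9/20`). [this work] -/
theorem le_one_reached_le_of_hairs_ge_twoFifths (w : Sym2 (Fin n) → unitInterval) (R : Finset (Fin n)) (o a b c : Fin n)
    (t : ℝ) (hR : R = {a, b, c}) (hao : a ≠ o) (hbo : b ≠ o) (hco : c ≠ o) (hab : a ≠ b) (hac : a ≠ c) (hbc : b ≠ c)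
    (hobs : ∀ u, u ≠ o → u ≠ a → u ≠ b → u ≠ c → w s(o, u) = 0)
    (hαlo : (2 / 5 : ℝ) ≤ w s(o, a)) (hβlo : (2 / 5 : ℝ) ≤ w s(o, b)) (hγlo : (2 / 5 : ℝ) ≤ w s(o, c))
    (hsum : 2 < (prodBernoulli w).real (openConn o a) + (prodBernoulli w).real (openConn o b) +
      (prodBernoulli w).real (openConn o c))
    (hta : (prodBernoulli w).real (openConn o a)ᶜ ≤ t) (htb : (prodBernoulli w).real (openConn o b)ᶜ ≤ t)
    (htc : (prodBernoulli w).real (openConn o c)ᶜ ≤ t) :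
    (prodBernoulli w).real {ω : BondConfig (Fin n) | (R.filter fun v => ω ∈ openConn o v).card ≤ 1} ≤ t := by
  by_cases hhi : (w s(o, a) : ℝ) ≤ 1 / 2 ∧ (w s(o, b) : ℝ) ≤ 1 / 2 ∧ (w s(o, c) : ℝ) ≤ 1 / 2
  · exact le_one_reached_le_of_twoFifths_hairs w R o a b c t hR hao hbo hco hab hac hbc hobs hαlo hhi.1 hβlo hhi.2.1
      hγlo hhi.2.2 hsum hta htb htc
  have hhalf : (1 / 2 : ℝ) ≤ w s(o, a) ∨ (1 / 2 : ℝ) ≤ w s(o, b) ∨ (1 / 2 : ℝ) ≤ w s(o, c) := by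
    by_contra h
    push Not at h
    exact hhi ⟨h.1.le, h.2.1.le, h.2.2.le⟩
  have ha : a ∈ R := (by simp [hR]); have hb : b ∈ R := (by simp [hR]); have hc : c ∈ R := by simp [hR]
  have hobs' : ∀ u, u ≠ o → u ≠ b → u ≠ a → u ≠ c → w s(o, u) = 0 := fun u h1 h2 h3 h4 => hobs u h1 h3 h2 h4
  have hobs'' : ∀ u, u ≠ o → u ≠ c → u ≠ a → u ≠ b → w s(o, u) = 0 := fun u h1 h2 h3 h4 => hobs u h1 h3 h4 h2
  set μ := prodBernoulli w with hμ
  rcases le_total (μ.real (openConn o a)) (μ.real (openConn o b)) with hqab | hqba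
  · rcases le_total (μ.real (openConn o a)) (μ.real (openConn o c)) with hqac | hqca
    · exact (OneCutFive.measureReal_le_one_le_compl_of_exchange w R o a b c ha hb hc hab hac hbc
        (pocketExchange_of_half_le_hair w o a b c hao hbo hco hab hac hbc hobs hhalf hqab hqac)).trans hta
    · have hhalf' : (1 / 2 : ℝ) ≤ w s(o, c) ∨ (1 / 2 : ℝ) ≤ w s(o, a) ∨ (1 / 2 : ℝ) ≤ w s(o, b) := by tauto
      exact (OneCutFive.measureReal_le_one_le_compl_of_exchange w R o c a b hc ha hb hac.symm hbc.symm hab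
        (pocketExchange_of_half_le_hair w o c a b hco hao hbo hac.symm hbc.symm hab hobs'' hhalf' hqca
          (hqca.trans hqab))).trans htc
  · rcases le_total (μ.real (openConn o b)) (μ.real (openConn o c)) with hqbc | hqcb
    · have hhalf' : (1 / 2 : ℝ) ≤ w s(o, b) ∨ (1 / 2 : ℝ) ≤ w s(o, a) ∨ (1 / 2 : ℝ) ≤ w s(o, c) := by tauto
      exact (OneCutFive.measureReal_le_one_le_compl_of_exchange w R o b a c hb ha hc hab.symm hbc hac
        (pocketExchange_of_half_le_hair w o b a c hbo hao hco hab.symm hbc hac hobs' hhalf' hqba hqbc)).trans htb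
    · have hhalf' : (1 / 2 : ℝ) ≤ w s(o, c) ∨ (1 / 2 : ℝ) ≤ w s(o, a) ∨ (1 / 2 : ℝ) ≤ w s(o, b) := by tauto
      exact (OneCutFive.measureReal_le_one_le_compl_of_exchange w R o c a b hc ha hb hac.symm hbc.symm hab
        (pocketExchange_of_half_le_hair w o c a b hco hao hbo hac.symm hbc.symm hab hobs'' hhalf' (hqcb.trans hqba)
          hqcb)).trans htc

end ThreePort

end Summit.CriticalPhenomena.PercolationContinuityZ3.Theorems

end
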